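import Literature.Computability.Complexity.RandomizingPolynomialsShape
import HarnessLib

/-!
# Randomizing polynomials IX′: the corner value of a branching-program matrix is its determinant

File IX of the series (`RandomizingPolynomialsShape.lean`) factors every matrix `M` of branching-program
shape over `F₂` as `M = U(M) · C_{δ(M)} · V(M)` with the CORNER VALUE `δ(M) = corner M` defined by an
explicit formula ("print: `δ = det M` up to sign").  This file proves that identity:

* `corner_eq_det` — `corner M = det M` for every `IsBPShape M` (via private copies of the unipotence of
  both randomizer families and of `det C_δ = δ`, which are PUBLIC in `RandomizingPolynomialsHessenberg.lean`
  as `IsUnitri.det_eq_one`, `IsLastCol.det_eq_one`, `det_canon` — not imported here to keep this bridge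
  file on the `Shape` cone);
* `eq_shiftU_mul_canon_det_mul_colV` — the canonical form with `det M` in the corner.

So the canonical form reads `A · M · B = C_{det M}` with `A = unshiftU M` unitriangular and `B = colV M`
last-column, the form in which Ishai–Kushilevitz state it (the value of a branching program is the
determinant of its matrix `L(x)`), and in which the crux line `dual-mode-compile` of PneNP/SzkEntropy
registered its stubs `stub_canon` / `stub_blockPerf`.

## References

* Y. Ishai, E. Kushilevitz, *Perfect constant-round secure computation via perfect randomizing
  polynomials*, ICALP 2002, §3 (Lemma 1: the canonical form `C_{det L}`).
* B. Applebaum, Y. Ishai, E. Kushilevitz, *Cryptography in NC⁰*, SIAM J. Comput. 36 (2006), §4.3,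
  Fact 4.14.
-/

namespace Literature.Computability.Complexity.RandPoly

open Matrix Finset

variable {d : ℕ}

/-- An upper unitriangular matrix has determinant `1`. [folklore] -/
private theorem isUnitri_det_eq_one' {A : Mat d} (hA : IsUnitri A) : A.det = 1 := by
  rw [Matrix.det_of_upperTriangular (fun i j hij => hA.2 i j hij)]
  exact Finset.prod_eq_one fun i _ => hA.1 i

/-- A last-column matrix has determinant `1`. [folklore] -/
private theorem isLastCol_det_eq_one' {B : Mat d} (hB : IsLastCol B) : B.det = 1 := by
  have hup : B.BlockTriangular id := by
    intro i j hij
    refine hB.2 i j (ne_of_gt hij) fun hj => ?_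
    subst hj
    exact absurd (Fin.le_last i) (not_le.2 hij)
  rw [Matrix.det_of_upperTriangular hup]
  exact Finset.prod_eq_one fun i _ => hB.1 i

/-- **`det C_δ = δ`** (Laplace expansion along row `0`, whose only nonzero entry is the corner `δ`; the
minor is the identity; over `F₂` the sign `(-1)^d` is `1`). [cite: IshaiKushilevitz2002, §3] -/
private theorem det_canon' (δ : ZMod 2) : (canon (d := d) δ).det = δ := by
  rw [Matrix.det_succ_row_zero, Finset.sum_eq_single (Fin.last d)]
  · have hsub : (canon (d := d) δ).submatrix Fin.succ (Fin.last d).succAbove = 1 := by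
      ext i j
      rw [Fin.succAbove_last]
      simp only [submatrix_apply, canon, pathMat, of_apply, Pi.zero_apply, ite_self, zero_add,
        Fin.val_succ, Fin.val_castSucc, Fin.succ_ne_zero, false_and, if_false, add_zero, one_apply]
      by_cases hij : i = j
      · subst hij; simp
      · rw [if_neg (fun h => hij (Fin.ext (by omega))), if_neg hij]
    rw [hsub, det_one, mul_one]
    have hlast : (canon (d := d) δ) 0 (Fin.last d) = δ := by
      simp [canon, pathMat]
    rw [hlast, show (-1 : ZMod 2) = 1 from by decide, one_pow, one_mul]
  · intro j _ hj
    have : (canon (d := d) δ) 0 j = 0 := by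
      simp [canon, pathMat, hj]
    rw [this, mul_zero, zero_mul]
  · intro h; exact absurd (Finset.mem_univ _) h

/-- **The corner value is the determinant** for matrices of branching-program shape:
`det M = det U(M) · det C_{δ(M)} · det V(M) = δ(M)`. [cite: ApplebaumIshaiKushilevitz2006, Fact 4.14] -/
theorem corner_eq_det {M : Mat d} (h : IsBPShape M) : corner M = M.det := by
  conv_rhs => rw [eq_shiftU_mul_canon_mul_colV h]
  rw [det_mul, det_mul, isUnitri_det_eq_one' (shiftU_isUnitri h), isLastCol_det_eq_one' (colV_isLastCol M),
    det_canon']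
  ring

/-- The canonical form with the determinant in the corner: `M = U(M) · C_{det M} · V(M)` for every matrix
of branching-program shape. [cite: IshaiKushilevitz2002, §3] -/
theorem eq_shiftU_mul_canon_det_mul_colV {M : Mat d} (h : IsBPShape M) :
    M = shiftU M * canon M.det * colV M := by
  rw [← corner_eq_det h]
  exact eq_shiftU_mul_canon_mul_colV h

end Literature.Computability.Complexity.RandPoly
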